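import Summits.HubbardSuperconductivity.HubbardSuperconductivity.Theorems.AnisotropyChordTransferFibre3RowCXSPointwise

/-!
# Route `AnisotropyChord` / H0 rotor rung, row C (KT-2b): the TAIL majorant of the summand of `XSn`

Continuation of `…RowCXSPointwise` (`s(k) = θ²|u(k)|²`, `XSn = Σ_k s(k)`, scaled factors `G = X₀(k)`, `G₋ = X_{(−1,0)}(k)`,
weights `aₓ, a_y, e`, `d = aₓ(k) − aₓ(k − x̂)`):
* ★ `cos_diff_sq_le` / `d_sq_le`: the trigonometric inequality `d² ≤ 2e·(aₓ(k) + aₓ(k − x̂))`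
  (⟺ `0 ≤ (cos A − cos h)² + sin²h`);
* `sN_le_split`: `s(k) ≤ 2aₓ(G − G₋)² + 2e·G₋²` (`|α + β|² ≤ 2|α|² + 2|β|²`);
* `Xf_le_Gmax`: `G ≤ G_max = 1/((1 − θ₀²/12) − ν)` for `θ ≤ θ₀ ≤ π` (`2(1 − cos θ) ≥ θ²(1 − θ²/12)`, `ε(k) ≥ ε₁`);
* ★ `sN_tail_le`: for every `k ≠ x̂`, `s(k) ≤ (4c² + 2)·G₋² + 4c²·G·G₋`, `c = cTail ν θ₀ = 1 + ν·G_max`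
  (`aₓG = 1 − (a_y − ν)G ≤ 1 + νG ≤ c`), so that the tail of `XSn` is controlled by the TOTALS `θ⁴S₂ = Σ G₋²`,
  `θ⁴T10 = Σ G G₋` (p2's B1 brackets) minus window lower sums — no Jordan constant, no `ℤ²` tail lemma.
Prover seat `hubbard-h0-rotor-p1` g28 (route lead); helper for piece A = stmt-HubbardSuperconductivity-23918 of rung 19089
(`--supports`, helper class).  WHAT THIS IS NOT: nothing here proves superconductivity in the Hubbard model; pointwise lemmas
for one input of ONE row of ONE conditional reduction; the rotor TARGET as originally worded stays FALSE (g15 verdict).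
Tree imports only; no sorry, no new axioms.
-/

set_option linter.dupNamespace false
set_option autoImplicit false

noncomputable section

open scoped BigOperators
open Complex

namespace Summit.HubbardSuperconductivity.HubbardSuperconductivity.Theorems.AnisotropyChord.Transfer.Fibre3

namespace RowC

open B1

variable (L : ℕ) [NeZero L]

/-! ## The trigonometric inequality `d² ≤ 2e(aₓ + aₓ₋)` -/

omit [NeZero L] in
/-- `(cos(A − h) − cos(A + h))² ≤ 2(1 − cos 2h)(2 − cos(A + h) − cos(A − h))`
(equivalent to `0 ≤ (cos A − cos h)² + sin²h`). [folklore] -/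
theorem cos_diff_sq_le (A h : ℝ) :
    (Real.cos (A - h) - Real.cos (A + h)) ^ 2
      ≤ 2 * (1 - Real.cos (2 * h)) * (2 - Real.cos (A + h) - Real.cos (A - h)) := by
  rw [Real.cos_sub, Real.cos_add, Real.cos_two_mul]
  have hA := Real.sin_sq_add_cos_sq A
  have hh := Real.sin_sq_add_cos_sq h
  nlinarith [sq_nonneg (Real.cos A - Real.cos h), sq_nonneg (Real.sin h), sq_nonneg (Real.sin A * Real.sin h),
    mul_nonneg (sq_nonneg (Real.sin h)) (sq_nonneg (Real.cos A - Real.cos h)),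
    mul_nonneg (sq_nonneg (Real.sin h)) (sq_nonneg (Real.sin h))]

/-- the angle of `k − x̂` is the angle of `k` minus `θ` (through `cos`). [folklore] -/
theorem cos_angle_sub_K1 (k : Tor L) :
    (phase L (k - K1 L) (ex L)).re = Real.cos (2 * Real.pi * (k.1.val : ℝ) / L - 2 * Real.pi / L) := by
  rw [phase_ex_re]
  have h1 : (k - K1 L).1 = (((k.1.val : ℤ) - 1 : ℤ) : ZMod L) := by
    unfold K1; push_cast; simp
  rw [h1, cos_two_pi_val_intCast]
  congr 1
  have hL : (L : ℝ) ≠ 0 := by exact_mod_cast NeZero.ne L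
  push_cast
  field_simp

/-- ★ `d² ≤ 2e·(aₓ(k) + aₓ(k − x̂))`, `d = aₓ(k) − aₓ(k − x̂)`. [folklore] -/
theorem d_sq_le (k : Tor L) :
    (ax L k - ax L (k - K1 L)) ^ 2 ≤ 2 * ee L * (ax L k + ax L (k - K1 L)) := by
  have hLpos : (0 : ℝ) < L := by exact_mod_cast Nat.pos_of_ne_zero (NeZero.ne L)
  have hθ : 0 < (2 * Real.pi / L) ^ 2 := by positivity
  unfold ax ee eps1
  rw [cos_angle_sub_K1, phase_ex_re]
  set u : ℝ := 2 * Real.pi * (k.1.val : ℝ) / L with hu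
  set θ : ℝ := 2 * Real.pi / L with hθdef
  have key := cos_diff_sq_le (u - θ / 2) (θ / 2)
  have e1 : u - θ / 2 - θ / 2 = u - θ := by ring
  have e2 : u - θ / 2 + θ / 2 = u := by ring
  have e3 : 2 * (θ / 2) = θ := by ring
  rw [e1, e2, e3] at key
  have hθ2 : 0 < θ ^ 2 := by rw [hθdef]; exact hθ
  rw [show (2 * (1 - Real.cos u) / θ ^ 2 - 2 * (1 - Real.cos (u - θ)) / θ ^ 2) ^ 2
      = 4 * (Real.cos (u - θ) - Real.cos u) ^ 2 / (θ ^ 2) ^ 2 by field_simp; ring]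
  rw [show 2 * (2 * (1 - Real.cos θ) / θ ^ 2) * (2 * (1 - Real.cos u) / θ ^ 2 + 2 * (1 - Real.cos (u - θ)) / θ ^ 2)
      = 4 * (2 * (1 - Real.cos θ) * (2 - Real.cos u - Real.cos (u - θ))) / (θ ^ 2) ^ 2 by field_simp; ring]
  apply div_le_div_of_nonneg_right _ (by positivity)
  linarith

omit [NeZero L] in
/-- `|α + β|² ≤ 2|α|² + 2|β|²`. [folklore] -/
theorem normSq_add_le_two (α β : ℂ) : Complex.normSq (α + β) ≤ 2 * Complex.normSq α + 2 * Complex.normSq β := by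
  have h1 := Complex.normSq_add α β
  have h2 := Complex.normSq_sub α β
  have h3 := Complex.normSq_nonneg (α - β)
  linarith

/-- the crude split `s(k) ≤ 2aₓ(G − G₋)² + 2e·G₋²`. [folklore] -/
theorem sN_le_split (ν : ℝ) (k : Tor L) :
    sN L ν k ≤ 2 * (ax L k * (Xf L ν ((0 : ℤ), (0 : ℤ)) k - Xf L ν ((-1 : ℤ), (0 : ℤ)) k) ^ 2)
      + 2 * (ee L * Xf L ν ((-1 : ℤ), (0 : ℤ)) k ^ 2) := by
  have hLpos : (0 : ℝ) < L := by exact_mod_cast Nat.pos_of_ne_zero (NeZero.ne L)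
  have hθ : 0 < (2 * Real.pi / L) ^ 2 := by positivity
  set θ2 : ℝ := (2 * Real.pi / L) ^ 2 with hθ2
  rw [Xf_zero_eq, Xf_negx_eq, ← hθ2]
  unfold sN xsTerm
  rw [← hθ2]
  set g : ℝ := gres L (ν * θ2) k
  set gm : ℝ := gres L (ν * θ2) (k - K1 L)
  have h := normSq_add_le_two ((1 - zPh L k (ex L)) * (((g - gm : ℝ)) : ℂ)) ((1 - zPh L (K1 L) (ex L)) * ((gm : ℝ) : ℂ))
  rw [Complex.normSq_mul, Complex.normSq_mul, Complex.normSq_ofReal, Complex.normSq_ofReal, OuterMaj.normSq_one_sub_zPh,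
    OuterMaj.normSq_one_sub_zPh, OuterMaj.phase_K1_ex_re] at h
  have hmul := mul_le_mul_of_nonneg_left h hθ.le
  refine hmul.trans (le_of_eq ?_)
  unfold ax ee
  rw [← hθ2]
  field_simp
  ring

/-- `Re φ ≤ 1` for a character value. [folklore] -/
theorem re_phase_le_one (k e : Tor L) : (phase L k e).re ≤ 1 := by
  have h := normSq_phase L k e
  rw [Complex.normSq_apply] at h
  nlinarith [sq_nonneg (phase L k e).im, sq_nonneg ((phase L k e).re - 1)]

/-- `aₓ, a_y, e ≥ 0`. [folklore] -/
theorem ax_nonneg (k : Tor L) : 0 ≤ ax L k := by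
  unfold ax
  apply div_nonneg _ (sq_nonneg _)
  have := re_phase_le_one L k (ex L)
  linarith

/-- see `ax_nonneg`. [folklore] -/
theorem ay_nonneg (k : Tor L) : 0 ≤ ay L k := by
  unfold ay
  apply div_nonneg _ (sq_nonneg _)
  have := re_phase_le_one L k (ey L)
  linarith

/-- `0 ≤ e ≤ 1` (`2(1 − cos θ) ≤ θ²`). [folklore] -/
theorem ee_nonneg_le_one : 0 ≤ ee L ∧ ee L ≤ 1 := by
  have hLpos : (0 : ℝ) < L := by exact_mod_cast Nat.pos_of_ne_zero (NeZero.ne L)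
  have hθ : 0 < (2 * Real.pi / L) ^ 2 := by positivity
  unfold ee eps1
  constructor
  · apply div_nonneg _ hθ.le
    have := Real.cos_le_one (2 * Real.pi / L)
    linarith
  · rw [div_le_one hθ]
    have := Real.one_sub_sq_div_two_le_cos (x := 2 * Real.pi / L)
    linarith

/-- the uniform factor bound `G ≤ 1/((1 − θ₀²/12) − ν)` (`θ ≤ θ₀ ≤ π`... only `2(1−cos θ) ≥ θ²(1 − θ²/12)` and `ε(k) ≥ ε₁` used). [folklore] -/
theorem Xf_le_Gmax (ν θ0 : ℝ) (hθ0 : 2 * Real.pi / L ≤ θ0) (hθ0π : θ0 ≤ Real.pi)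
    (hden : 0 < 1 - θ0 ^ 2 / 12 - ν) (hL : 2 ≤ L) (t : ℤ × ℤ) (k : Tor L) :
    Xf L ν t k ≤ 1 / (1 - θ0 ^ 2 / 12 - ν) := by
  have hLpos : (0 : ℝ) < L := by exact_mod_cast Nat.pos_of_ne_zero (NeZero.ne L)
  have hθpos : 0 < 2 * Real.pi / L := by positivity
  have hθ : 0 < (2 * Real.pi / L) ^ 2 := by positivity
  unfold Xf gres
  split_ifs with hk
  · rw [mul_zero]; exact div_nonneg zero_le_one hden.le
  · have hε := eps1_le_epsT L hL hk
    -- `2ε₁ ≥ θ²(1 − θ²/12) ≥ θ²(1 − θ₀²/12)`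
    have hq := sq_sub_quartic_le (2 * Real.pi / L) (by
      rw [abs_of_pos hθpos]; exact hθ0.trans hθ0π)
    have hθθ0 : (2 * Real.pi / L) ^ 2 ≤ θ0 ^ 2 := pow_le_pow_left₀ hθpos.le hθ0 2
    have h1 : (2 * Real.pi / L) ^ 2 * (1 - θ0 ^ 2 / 12 - ν)
        ≤ 2 * epsT L (k + toTor L t) - ν * (2 * Real.pi / L) ^ 2 := by
      unfold eps1 at hε
      have : (2 * Real.pi / L) ^ 2 * (1 - θ0 ^ 2 / 12) ≤ (2 * Real.pi / L) ^ 2 - ((2 * Real.pi / L) ^ 2) ^ 2 / 12 := by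
        nlinarith
      nlinarith
    have hpos : 0 < 2 * epsT L (k + toTor L t) - ν * (2 * Real.pi / L) ^ 2 := by
      have := mul_pos hθ hden; linarith
    rw [mul_one_div, div_le_div_iff₀ hpos hden]
    linarith

/-- the tail constant `c = 1 + ν·G_max`, `G_max = 1/((1 − θ₀²/12) − ν)`. -/
def cTail (ν θ0 : ℝ) : ℝ := 1 + ν * (1 / (1 - θ0 ^ 2 / 12 - ν))

/-- ★ THE TAIL MAJORANT: for `k ≠ x̂`, `s(k) ≤ (4c² + 2)·G₋² + 4c²·G·G₋`, `c = cTail ν θ₀`. [folklore] -/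
theorem sN_tail_le (ν θ0 : ℝ) (hν0 : 0 ≤ ν) (hν : ν < 4 / Real.pi ^ 2) (hθ0 : 2 * Real.pi / L ≤ θ0)
    (hθ0π : θ0 ≤ Real.pi) (hden : 0 < 1 - θ0 ^ 2 / 12 - ν) (hL : 2 ≤ L) (k : Tor L) (hk1 : k ≠ K1 L) :
    sN L ν k ≤ (4 * cTail ν θ0 ^ 2 + 2) * Xf L ν ((-1 : ℤ), (0 : ℤ)) k ^ 2
      + 4 * cTail ν θ0 ^ 2 * (Xf L ν ((0 : ℤ), (0 : ℤ)) k * Xf L ν ((-1 : ℤ), (0 : ℤ)) k) := by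
  set c := cTail ν θ0 with hcdef
  set G := Xf L ν ((0 : ℤ), (0 : ℤ)) k with hGdef
  set Gm := Xf L ν ((-1 : ℤ), (0 : ℤ)) k with hGmdef
  have hG0 : 0 ≤ G := Xf_nonneg L ν hν _ _
  have hGm0 : 0 ≤ Gm := Xf_nonneg L ν hν _ _
  have hGG : 0 ≤ G * Gm := mul_nonneg hG0 hGm0
  have hGmax : G ≤ 1 / (1 - θ0 ^ 2 / 12 - ν) := Xf_le_Gmax L ν θ0 hθ0 hθ0π hden hL _ k
  have hGmmax : Gm ≤ 1 / (1 - θ0 ^ 2 / 12 - ν) := Xf_le_Gmax L ν θ0 hθ0 hθ0π hden hL _ k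
  have hM0 : 0 ≤ 1 / (1 - θ0 ^ 2 / 12 - ν) := div_nonneg zero_le_one hden.le
  have hc1 : 1 ≤ c := by
    rw [hcdef]; unfold cTail
    have : 0 ≤ ν * (1 / (1 - θ0 ^ 2 / 12 - ν)) := mul_nonneg hν0 hM0
    linarith
  have hc0 : 0 ≤ c := le_trans zero_le_one hc1
  have hνG : 1 + ν * G ≤ c := by
    rw [hcdef]; unfold cTail
    have := mul_le_mul_of_nonneg_left hGmax hν0
    linarith
  have hνGm : 1 + ν * Gm ≤ c := by
    rw [hcdef]; unfold cTail
    have := mul_le_mul_of_nonneg_left hGmmax hν0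
    linarith
  obtain ⟨he0, he1⟩ := ee_nonneg_le_one L
  have hax := ax_nonneg L k
  have haxm := ax_nonneg L (k - K1 L)
  have hay := ay_nonneg L k
  have hsplit := sN_le_split L ν k
  rw [← hGdef, ← hGmdef] at hsplit
  have hc2 : 0 ≤ c ^ 2 := sq_nonneg c
  have hP1 : 0 ≤ c ^ 2 * Gm ^ 2 := mul_nonneg hc2 (sq_nonneg Gm)
  have hP2 : 0 ≤ c ^ 2 * (G * Gm) := mul_nonneg hc2 hGG
  -- the second piece
  have h2 : 2 * (ee L * Gm ^ 2) ≤ 2 * Gm ^ 2 := by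
    have := mul_le_mul_of_nonneg_right he1 (sq_nonneg Gm)
    linarith
  -- the first piece
  have h1 : 2 * (ax L k * (G - Gm) ^ 2) ≤ 4 * c ^ 2 * Gm ^ 2 + 4 * c ^ 2 * (G * Gm) := by
    by_cases hk0 : k = 0
    · have hax0 : ax L k = 0 := by
        rw [hk0]; unfold ax; rw [phase_zero_left]; simp
      rw [hax0, zero_mul, mul_zero]
      linarith
    · have hGE := Xf_mul_energy L ν hν k hk0
      have hGmE := Xf_negx_mul_energy L ν hν k hk1
      rw [← hGdef] at hGE
      rw [← hGmdef] at hGmE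
      have hdiff : G - Gm = -((ax L k - ax L (k - K1 L)) * G * Gm) := by
        linear_combination Gm * hGE - G * hGmE
      have hd := d_sq_le L k
      have haG : ax L k * G ≤ c := by
        have e : ax L k * G = 1 - ay L k * G + ν * G := by linear_combination hGE
        have := mul_nonneg hay hG0
        linarith
      have haGm : ax L (k - K1 L) * Gm ≤ c := by
        have e : ax L (k - K1 L) * Gm = 1 - ay L k * Gm + ν * Gm := by linear_combination hGmE
        have := mul_nonneg hay hGm0
        linarith
      have haG0 : 0 ≤ ax L k * G := mul_nonneg hax hG0
      have haGm0 : 0 ≤ ax L (k - K1 L) * Gm := mul_nonneg haxm hGm0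
      set X : ℝ := (ax L k * G) ^ 2 * Gm ^ 2 + (ax L k * G) * (ax L (k - K1 L) * Gm) * (G * Gm) with hX
      have hX0 : 0 ≤ X := by
        rw [hX]
        exact add_nonneg (mul_nonneg (sq_nonneg _) (sq_nonneg _)) (mul_nonneg (mul_nonneg haG0 haGm0) hGG)
      have step1 : ax L k * (G - Gm) ^ 2 ≤ ax L k * (2 * ee L * (ax L k + ax L (k - K1 L))) * (G * Gm) ^ 2 := by
        rw [hdiff]
        have : (-((ax L k - ax L (k - K1 L)) * G * Gm)) ^ 2 = (ax L k - ax L (k - K1 L)) ^ 2 * (G * Gm) ^ 2 := by ring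
        rw [this, ← mul_assoc]
        apply mul_le_mul_of_nonneg_right _ (sq_nonneg _)
        exact mul_le_mul_of_nonneg_left hd hax
      have step2 : ax L k * (2 * ee L * (ax L k + ax L (k - K1 L))) * (G * Gm) ^ 2 ≤ 2 * X := by
        have e : ax L k * (2 * ee L * (ax L k + ax L (k - K1 L))) * (G * Gm) ^ 2 = ee L * (2 * X) := by
          rw [hX]; ring
        rw [e]
        have := mul_le_mul_of_nonneg_right he1 (by linarith : (0 : ℝ) ≤ 2 * X)
        linarith
      have step3 : (ax L k * G) ^ 2 * Gm ^ 2 ≤ c ^ 2 * Gm ^ 2 := by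
        apply mul_le_mul_of_nonneg_right _ (sq_nonneg _)
        exact pow_le_pow_left₀ haG0 haG 2
      have step4 : (ax L k * G) * (ax L (k - K1 L) * Gm) * (G * Gm) ≤ c ^ 2 * (G * Gm) := by
        rw [sq]
        apply mul_le_mul_of_nonneg_right _ hGG
        exact mul_le_mul haG haGm haGm0 hc0
      have hXle : X ≤ c ^ 2 * Gm ^ 2 + c ^ 2 * (G * Gm) := by rw [hX]; linarith
      linarith [step1, step2, hXle]
  linarith [hsplit, h1, h2]

end RowC

end Summit.HubbardSuperconductivity.HubbardSuperconductivity.Theorems.AnisotropyChord.Transfer.Fibre3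

end
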